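import Summits.ResolutionOfSingularities.ResolutionOfSingularities.Theorems.EquisingularLiftEquisingularLiftNatEquinodalNoseModel
import HarnessLib

/-!
# EL♮(3), non-planar noses (NU7-NOSE-SIZING v1.2 §S Σ5a «ci-DIRECT»): THE COMPLETE-INTERSECTION MODEL `𝓦 = (F₁, F₂)~ ⊂ ℙⁿ_O` —
# `ϖ`-SATURATION FROM RELATIVELY PRIME REDUCTIONS (Koszul), hence `O`-FLATNESS, and the REDUCED TRACE `𝓘⟨V₊(f₁) ∩ V₊(f₂)⟩` from a radical `(f₁, f₂)`

res-L1-w45b-nose-w1 g6 (WIDTH seat D-0157 DOOR 1, nose residue).  CUSTOMER-INDEPENDENT BANKED SUPPORT (desk RULING R70 (iii) precedent; it changes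
no door text, deals no width, touches no stub — F4 intact): res-L1-w45b-lead-1 g19's SPACE ISLAND NOSE `S♯_ν(G₇)` (cell bus 2026-08-29T06:50:26Z,
memo `SHARP7-CERTIFICATE.md` 70f4d67028538f11) is a NON-PLANAR complete-intersection nose `Z′ = V₊(q) ∩ V₊(h)` whose upstairs supplier (NU7 §S Σ5a,
res-L1-w45b-idea-2) is the explicit ci smoothing `𝒞 = V(q̃ + ϖU₁, h̃ + ϖU₂)`.  As for the planar door (res-L1-w45b-stub-2 g19's ✓ `smoothing_trace_and_flat`,
p701505), two of the three conjuncts the HEND block wants — REDUCED TRACE and `O`-FLATNESS — do not depend on the perturbation and hold for ANY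
homogeneous lifts `F₁, F₂` of `f₁, f₂`; this module proves them once, in the currency of ✓ `hendBlock_stage_zero_of_model` (p702606):

* ★ `CIModel.mem_span_pair_of_C_mul_mem` (pure algebra, the KOSZUL step): `O → k` a surjection with kernel `(ϖ)`, `O` a domain, `ϖ ≠ 0`;
  if the reductions `f₁, f₂ ∈ k[x_σ]` of `F₁, F₂ ∈ O[x_σ]` are RELATIVELY PRIME and `f₂ ≠ 0`, then `(F₁, F₂)` is `ϖ`-saturated:
  `C ϖ · y ∈ (F₁, F₂) ⇒ y ∈ (F₁, F₂)` (`ϖy = aF₁ + bF₂ ⇒ āf₁ + b̄f₂ = 0 ⇒ ā = c f₂, b̄ = −c f₁ ⇒ a = c̃F₂ + ϖa′, b = −c̃F₁ + ϖb′ ⇒ y = a′F₁ + b′F₂`).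
* ★ `CIModel.ci_trace_and_flat` — at the INITIAL stage `(ℙⁿ_O, Proj φ)`: for homogeneous `F₁, F₂` of degrees `d₁, d₂` with reductions `f₁, f₂`
  (`IsRelPrime f₁ f₂`, `f₂ ≠ 0`, `(f₁, f₂)` a RADICAL ideal of `k[x₀..xₙ]`), the ci model `𝓦 := (F₁, F₂)~` has `𝓦.comap (Proj φ) = 𝓘⟨Z⟩` for
  `Z = {y | f₁ ∈ y ∧ f₂ ∈ y}` (✓ `NoseModel.comap_eq_vanishingIdeal_of_isRadical`) and `V(𝓦) → Spec O` FLAT (✓ `SatLift.flat_subschemeι_projIdealSheaf_of_saturated`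
  on the Koszul saturation) — the two `c`-independent clauses of a Σ5a supplier `𝒞_c = V(F₁, F₂ + c·ϖ·M̃)`; the third (`V(𝓦)` REGULAR for `c` off a
  finite bad set) is the planar one-bad-residue package with the hyperplane host replaced by a hypersurface host regular along `Z̃` — NOT here.

Elementary; no new fact; DEF-FREE; no `sorry`; standard axioms; `--supports stmt-ResolutionOfSingularities-20148 --as helper`, counted 0.  EL♮(3) is NOT
proved here; resolution of singularities in positive characteristic is NOT proved anywhere in this tree (dim 3 in print: Cossart–Piltant 2008/2009);
nothing of [Hironaka2017] is asserted.  References (method only): R. Hartshorne, *Algebraic Geometry* (1977), II Cor. 5.16, III Prop. 9.7.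
-/

set_option linter.dupNamespace false -- mandated namespace `Summit.<Summit>.<Problem>` of this single-conjunct summit
set_option linter.overlappingInstances false -- signatures carry `[IsDomain O] [IsDiscreteValuationRing O]`

noncomputable section

open CategoryTheory AlgebraicGeometry TopologicalSpace IsLocalRing
open MvPolynomial HomogeneousLocalization
open Literature.AlgebraicGeometry.Resolution Literature.RingTheory.GradedAlgebra

namespace Summit.ResolutionOfSingularities.ResolutionOfSingularities.Cruxes.EquisingularLiftNat.Sections.Equinodal.CIModel

/-! ## §1 The Koszul step: `(F₁, F₂)` is `ϖ`-saturated when the reductions are relatively prime -/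

section Koszul

variable {O : Type} [CommRing O] [IsDomain O] {k : Type} [Field k] (θ : O →+* k) (hθ : Function.Surjective θ)
  {σ : Type} (ϖ : O) (hϖ0 : ϖ ≠ 0) (hθϖ : θ ϖ = 0) (hker : ∀ r : O, θ r = 0 → ϖ ∣ r)

omit [IsDomain O] in
include hker in
/-- If the reduction of `P ∈ O[x_σ]` along `θ` vanishes then `P = C ϖ · P'` (`ker θ ⊆ (ϖ)`, Mathlib `MvPolynomial.ker_map`). [folklore] -/
theorem exists_eq_C_mul_of_map_eq_zero (P : MvPolynomial σ O) (hP : MvPolynomial.map θ P = 0) :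
    ∃ P' : MvPolynomial σ O, P = C ϖ * P' := by
  have h1 : P ∈ RingHom.ker (MvPolynomial.map (σ := σ) θ) := hP
  rw [MvPolynomial.ker_map] at h1
  have h2 : Ideal.map (C : O →+* MvPolynomial σ O) (RingHom.ker θ) ≤ Ideal.span {(C ϖ : MvPolynomial σ O)} := by
    rw [Ideal.map_le_iff_le_comap]
    intro r hr
    obtain ⟨s, hs⟩ := hker r hr
    exact Ideal.mem_comap.mpr (Ideal.mem_span_singleton.mpr ⟨C s, by rw [← map_mul, hs]⟩)
  obtain ⟨P', hP'⟩ := Ideal.mem_span_singleton.mp (h2 h1)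
  exact ⟨P', hP'⟩

include hθ hϖ0 hθϖ hker in
/-- ★ **KOSZUL: `(F₁, F₂) ⊂ O[x_σ]` is `ϖ`-SATURATED when the reductions `f₁, f₂` are relatively prime** (`O` a domain, `θ : O ↠ k` with kernel
`(ϖ)`, `ϖ ≠ 0`, `f₂ ≠ 0`): `C ϖ · y ∈ (F₁, F₂) ⇒ y ∈ (F₁, F₂)`.  The only syzygy of a relatively prime pair in the UFD `k[x_σ]` is the Koszul one,
which lifts. [folklore; Koszul] -/
theorem mem_span_pair_of_C_mul_mem (F₁ F₂ : MvPolynomial σ O)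
    (hrel : IsRelPrime (MvPolynomial.map θ F₁) (MvPolynomial.map θ F₂)) (hf₂ : MvPolynomial.map θ F₂ ≠ 0)
    (y : MvPolynomial σ O) (hy : C ϖ * y ∈ Ideal.span {F₁, F₂}) : y ∈ Ideal.span {F₁, F₂} := by
  obtain ⟨a, b, hab⟩ := Ideal.mem_span_pair.mp hy
  -- reduce: `ā f₁ + b̄ f₂ = 0`
  have hred : MvPolynomial.map θ a * MvPolynomial.map θ F₁ + MvPolynomial.map θ b * MvPolynomial.map θ F₂ = 0 := by
    have h := congrArg (MvPolynomial.map θ) hab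
    rw [map_add, map_mul, map_mul, map_mul, map_C, hθϖ, C_0, zero_mul] at h
    exact h
  -- `f₂ ∣ ā f₁`, hence `f₂ ∣ ā` (relatively prime in the UFD `k[x_σ]`): `ā = f₂ c`
  have hdvd : MvPolynomial.map θ F₂ ∣ MvPolynomial.map θ a * MvPolynomial.map θ F₁ :=
    ⟨-MvPolynomial.map θ b, by linear_combination hred⟩
  obtain ⟨c, hc⟩ := hrel.symm.dvd_of_dvd_mul_right hdvd
  -- then `b̄ = -c f₁` (cancel `f₂ ≠ 0`)
  have hb : MvPolynomial.map θ b = -(c * MvPolynomial.map θ F₁) := by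
    have h2 : MvPolynomial.map θ F₂ * (MvPolynomial.map θ b + c * MvPolynomial.map θ F₁) = 0 := by
      linear_combination hred - (MvPolynomial.map θ F₁) * hc
    rcases mul_eq_zero.mp h2 with h | h
    · exact absurd h hf₂
    · linear_combination h
  -- lift `c` and divide the two differences by `ϖ`
  obtain ⟨ct, hct⟩ := MvPolynomial.map_surjective θ hθ c
  obtain ⟨a', ha'⟩ := exists_eq_C_mul_of_map_eq_zero θ ϖ hker (a - F₂ * ct) (by
    rw [map_sub, map_mul, hct, hc, sub_self])
  obtain ⟨b', hb'⟩ := exists_eq_C_mul_of_map_eq_zero θ ϖ hker (b + ct * F₁) (by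
    rw [map_add, map_mul, hct, hb]; ring)
  -- `ϖ y = ϖ (a' F₁ + b' F₂)`, cancel `ϖ`
  have hC : (C ϖ : MvPolynomial σ O) ≠ 0 := by rwa [Ne, C_eq_zero]
  have hy' : y = a' * F₁ + b' * F₂ := by
    apply mul_left_cancel₀ hC
    have ha : a = F₂ * ct + C ϖ * a' := by linear_combination ha'
    have hb2 : b = -(ct * F₁) + C ϖ * b' := by linear_combination hb'
    rw [← hab, ha, hb2]
    ring
  rw [hy']
  exact Ideal.mem_span_pair.mpr ⟨a', b', rfl⟩

end Koszul

/-! ## §2 The ci model on `ℙⁿ_O`: reduced trace and flatness -/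

section Model

variable (O : Type) [CommRing O] [IsDomain O] [IsDiscreteValuationRing O] {k : Type} [Field k] (θ : O →+* k)
  (hθ : Function.Surjective θ) {n : ℕ}

include hθ in
/-- ★ **`V((F₁, F₂)~) → Spec O` IS FLAT when the reductions are relatively prime** (`O` a DVR, `θ : O ↠ k` its residue map): the Koszul saturation
(`mem_span_pair_of_C_mul_mem`) fed to ✓ `SatLift.flat_subschemeι_projIdealSheaf_of_saturated`. [cite: Hartshorne1977, III Prop. 9.7] -/
theorem flat_ci (F₁ F₂ : MvPolynomial (Fin (n + 1)) O) (d₁ d₂ : ℕ)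
    (hF : ∀ l, (![F₁, F₂] : Fin 2 → _) l ∈ homogeneousSubmodule (Fin (n + 1)) O ((![d₁, d₂] : Fin 2 → ℕ) l))
    (hrel : IsRelPrime (MvPolynomial.map θ F₁) (MvPolynomial.map θ F₂)) (hf₂ : MvPolynomial.map θ F₂ ≠ 0) :
    letI := MvPolynomial.gradedAlgebra (σ := Fin (n + 1)) (R := O)
    Flat ((projIdealSheaf (homogeneousSubmodule (Fin (n + 1)) O)
        ⟨Ideal.span (Set.range ![F₁, F₂]), isHomogeneous_span_of_forall_mem _ _ _ hF⟩).subschemeι ≫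
      (Proj.toSpecZero (homogeneousSubmodule (Fin (n + 1)) O) ≫
        Spec.map (CommRingCat.ofHom (algebraMap O ((homogeneousSubmodule (Fin (n + 1)) O) 0))))) := by
  letI := MvPolynomial.gradedAlgebra (σ := Fin (n + 1)) (R := O)
  obtain ⟨ϖ, hϖ⟩ := IsDiscreteValuationRing.exists_irreducible O
  refine SatLift.flat_subschemeι_projIdealSheaf_of_saturated O ϖ hϖ ![F₁, F₂] ![d₁, d₂] hF ?_
  intro y hy
  rw [NoseModel.span_range_pair] at hy ⊢
  have hmax : maximalIdeal O = Ideal.span {ϖ} := (IsDiscreteValuationRing.irreducible_iff_uniformizer ϖ).mp hϖ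
  have hkerθ : RingHom.ker θ = maximalIdeal O := IsLocalRing.eq_maximalIdeal (RingHom.ker_isMaximal_of_surjective θ hθ)
  have hθϖ : θ ϖ = 0 := by
    rw [← RingHom.mem_ker, hkerθ, hmax]; exact Ideal.mem_span_singleton_self ϖ
  have hker : ∀ r : O, θ r = 0 → ϖ ∣ r := by
    intro r hr
    rw [← RingHom.mem_ker, hkerθ, hmax] at hr
    exact Ideal.mem_span_singleton.mp hr
  exact mem_span_pair_of_C_mul_mem θ hθ ϖ hϖ.ne_zero hθϖ hker F₁ F₂ hrel hf₂ y hy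

include hθ in
/-- ★ **THE CI MODEL AT THE INITIAL STAGE: REDUCED TRACE AND FLATNESS** (the two `c`-independent clauses of a Σ5a supplier).  `O` a DVR with residue
map `θ : O ↠ k`, `φ` the graded coefficient map over `θ`; `F₁, F₂ ∈ O[x₀..xₙ]` homogeneous of degrees `d₁, d₂` with reductions `f₁, f₂` RELATIVELY PRIME,
`f₂ ≠ 0`, `(f₁, f₂)` RADICAL; `Z = {y | f₁ ∈ y ∧ f₂ ∈ y}`.  Then `𝓦 := (F₁, F₂)~` has `𝓦.comap (Proj φ) = 𝓘⟨Z⟩` and `V(𝓦) → Spec O` is flat — exactly the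
`h𝓦tr` / `h𝓦fl` inputs of ✓ `hendBlock_stage_zero_of_model` / ✓ `directNose_stage_zero_of_model`.
[OURS · L1 W4.5b · Σ5a banked support; counted 0; EL♮(3) NOT proved] -/
theorem ci_trace_and_flat :
    letI := MvPolynomial.gradedAlgebra (σ := Fin (n + 1)) (R := O); letI := MvPolynomial.gradedAlgebra (σ := Fin (n + 1)) (R := k);
    ∀ (φ : MvPolynomial.homogeneousSubmodule (Fin (n + 1)) O →+*ᵍ MvPolynomial.homogeneousSubmodule (Fin (n + 1)) k)
      (hφ' : HomogeneousIdeal.irrelevant (MvPolynomial.homogeneousSubmodule (Fin (n + 1)) k) ≤ (HomogeneousIdeal.irrelevant (MvPolynomial.homogeneousSubmodule (Fin (n + 1)) O)).map φ), (∀ s, φ s = MvPolynomial.map θ s) →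
    ∀ (F₁ F₂ : MvPolynomial (Fin (n + 1)) O) (d₁ d₂ : ℕ)
      (hF : ∀ l, (![F₁, F₂] : Fin 2 → _) l ∈ homogeneousSubmodule (Fin (n + 1)) O ((![d₁, d₂] : Fin 2 → ℕ) l)),
      IsRelPrime (MvPolynomial.map θ F₁) (MvPolynomial.map θ F₂) → MvPolynomial.map θ F₂ ≠ 0 →
      (Ideal.span {MvPolynomial.map θ F₁, MvPolynomial.map θ F₂}).IsRadical →
    ∀ (Z : Set (Proj (homogeneousSubmodule (Fin (n + 1)) k))) (hZ : IsClosed Z),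
      Z = {y : Proj (homogeneousSubmodule (Fin (n + 1)) k) | MvPolynomial.map θ F₁ ∈ y.asHomogeneousIdeal ∧ MvPolynomial.map θ F₂ ∈ y.asHomogeneousIdeal} →
    (projIdealSheaf (homogeneousSubmodule (Fin (n + 1)) O)
        ⟨Ideal.span (Set.range ![F₁, F₂]), isHomogeneous_span_of_forall_mem _ _ _ hF⟩).comap (Proj.map φ hφ') =
      Scheme.IdealSheafData.vanishingIdeal ⟨Z, hZ⟩ ∧
    Flat ((projIdealSheaf (homogeneousSubmodule (Fin (n + 1)) O)
        ⟨Ideal.span (Set.range ![F₁, F₂]), isHomogeneous_span_of_forall_mem _ _ _ hF⟩).subschemeι ≫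
      (Proj.toSpecZero (homogeneousSubmodule (Fin (n + 1)) O) ≫
        Spec.map (CommRingCat.ofHom (algebraMap O ((homogeneousSubmodule (Fin (n + 1)) O) 0))))) := by
  letI := MvPolynomial.gradedAlgebra (σ := Fin (n + 1)) (R := O)
  letI := MvPolynomial.gradedAlgebra (σ := Fin (n + 1)) (R := k)
  intro φ hφ' hφ F₁ F₂ d₁ d₂ hF hrel hf₂ hrad Z hZ hZeq
  refine ⟨?_, flat_ci O θ hθ F₁ F₂ d₁ d₂ hF hrel hf₂⟩
  -- the trace: ✓ `NoseModel.comap_eq_vanishingIdeal_of_isRadical` with `f = ![θF₁, θF₂]`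
  have hφX : ∀ i : Fin (n + 1), φ (X i) = X i := fun i => by rw [hφ, map_X]
  have hf : ∀ l, (![MvPolynomial.map θ F₁, MvPolynomial.map θ F₂] : Fin 2 → _) l ∈
      homogeneousSubmodule (Fin (n + 1)) k ((![d₁, d₂] : Fin 2 → ℕ) l) := by
    intro l
    fin_cases l
    · exact (mem_homogeneousSubmodule _ _).mpr (((mem_homogeneousSubmodule _ _).mp (hF 0)).map θ)
    · exact (mem_homogeneousSubmodule _ _).mpr (((mem_homogeneousSubmodule _ _).mp (hF 1)).map θ)
  have hφF : ∀ l, φ ((![F₁, F₂] : Fin 2 → _) l) = (![MvPolynomial.map θ F₁, MvPolynomial.map θ F₂] : Fin 2 → _) l := by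
    intro l
    fin_cases l
    · exact hφ F₁
    · exact hφ F₂
  have hradr : (Ideal.span (Set.range ![MvPolynomial.map θ F₁, MvPolynomial.map θ F₂])).IsRadical := by
    rw [NoseModel.span_range_pair]; exact hrad
  refine NoseModel.comap_eq_vanishingIdeal_of_isRadical φ hφ' hφX ![F₁, F₂] ![MvPolynomial.map θ F₁, MvPolynomial.map θ F₂] ![d₁, d₂]
    hF hf hφF hradr Z hZ ?_
  rw [hZeq]
  ext y
  simp only [Set.mem_setOf_eq, Fin.forall_fin_two, Matrix.cons_val_zero, Matrix.cons_val_one]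

end Model

end Summit.ResolutionOfSingularities.ResolutionOfSingularities.Cruxes.EquisingularLiftNat.Sections.Equinodal.CIModel

end
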